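import Summits.AtomisticToContinuum.HydrodynamicLimit.Theorems.MourreKoopmanChargesConservedVectorsOneBody
import Literature.Barriers.AtomisticToContinuum.MazurBoundBallistic
import HarnessLib

/-!
# `ConservedVectorsOneBody` (stmt-AtomisticToContinuum-14142): Cesàro / hydrodynamic-projection forms

Second support file for the support item `ConservedVectorsOneBody` of route `MourreKoopmanCharges`
(`Summit.AtomisticToContinuum.HydrodynamicLimit.Theses.MourreKoopmanCharges.ConservedVectorsOneBody`:
for every low-activity hard-sphere Gibbs datum `F` driven by (an a.e. representative of) Alexander's
equilibrium flow, `F.conservedSpace ≤ F.oneBodySector` — every Koopman-invariant vector of Spohn's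
fluctuation space `ℋ_F` lies in the closed one-body velocity sector `𝒟`). The item is the
infinite-volume "no hidden many-body charge" statement, one half of the open finite-dimensionality
problem for the conserved charges of the hard-sphere gas (Doyon 2022 §1; Spohn 1991 Part I §7.1);
the companion file `MourreKoopmanChargesConservedVectorsOneBody.lean` proves the virial road
(engine `CollisionCommutatorRegularityR`, stmt-13984, in the `C¹(A)` class). This file proves the
two ENGINE-FREE reformulations in which the physics literature actually states the claim, and the
item's position between the route's typed rungs:

* §1 (any `FluctuationDynamics`): **hydrodynamic-projection form** — for a closed subspace `S`,
  `𝒬₀ ≤ S` iff the hydrodynamic projection `ℙ = P_{𝒬₀}` (Doyon 2022 Thm 5.1) maps `ℋ` into `S`,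
  iff it maps the (dense) classes `[a]` of LOCAL OBSERVABLES into `S`
  (`conservedSpace_le_iff_hydroProjection_fluct_mem`): "the Euler-scale projection of every local
  observable is a one-body field".
* §2 (any strongly continuous `FluctuationDynamics`): the Koopman group is a strongly continuous
  contraction (semi)group in the sense of `Literature.Barriers.AtomisticToContinuum.Mazur`, its
  conserved vectors are `𝒬₀`, and hence — von Neumann's mean ergodic theorem in continuous time,
  PROVED in the tree as `Mazur.tendsto_inv_mul_integral_inner` — **Doyon's identification of the
  Drude weight with the Cesàro limit of the autocorrelation**,
  `τ⁻¹ ∫₀^τ ⟪U_t ψ, ψ⟫ dt → 𝖣_ψ = ‖ℙ ψ‖²` (`tendsto_cesaro_inner_koopman`; Doyon 2022 Thm 5.1,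
  which `FluctuationDynamics.drudeWeight` cites but does not restate), and the **Cesàro criterion**
  `𝒬₀ ≤ S ↔ ∀ φ ⊥ S, τ⁻¹ ∫₀^τ ⟪U_t φ, φ⟫ dt → 0` (`conservedSpace_le_iff_cesaro`).
* §3 (hard spheres): the item's conclusion for one datum `F` in two forms — projection of local
  observables, Cesàro decay off `𝒟` (given strong continuity). (NECESSITY — the item follows from
  completeness of the charges, `𝒞 ⊆ 𝒟` being a tree lemma — is in the glue file
  `MourreKoopmanChargesChargesCompleteHSGlue`.)
* §4 (the item's quantifier shape): `ConservedVectorsOneBody` in projection form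
  (`conservedVectorsOneBody_iff_hydroProjection`, `…_of_hydroProjection`) and from the
  Cesàro hypothesis "for every low-activity Gibbs datum with Alexander flow the Koopman group is
  strongly continuous and every vector orthogonal to `𝒟` has Cesàro-vanishing autocorrelation"
  (`conservedVectorsOneBody_of_cesaro`) — the infinite-volume statement of exactly the Cesàro shape
  of the route's torus crux `OneBodyCompleteness`, for the complementary sector `𝒟ᗮ`.

Nothing here proves the item: its content (absence of `U`-invariant vectors with a many-body
component for the infinite dynamics) is open, and no hard-sphere Gibbs datum is constructible in the
tree yet (`InfiniteHardSphereFlow.nonempty` is an unproved named fact).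

References: B. Doyon, Comm. Math. Phys. 391 (2022), §5.1 Thm 5.1; H. Spohn, *Large Scale Dynamics
of Interacting Particles* (1991), Part I §7.1; P. Mazur, Physica 43 (1969) 533.
-/

noncomputable section

open Filter Set MeasureTheory
open scoped InnerProductSpace Topology

namespace Summit.AtomisticToContinuum.HydrodynamicLimit.Theorems

open Literature.MathematicalPhysics.KineticTheory
open Literature.Barriers.AtomisticToContinuum (Mazur.IsContractionSemigroup Mazur.invariantSubspace)
open Summit.AtomisticToContinuum.HydrodynamicLimit.Theses.MourreKoopmanCharges (ConservedVectorsOneBody)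

namespace MourreKoopmanChargesConservedVectorsOneBody

/-! ## §1. Hydrodynamic-projection form (any fluctuation dynamics) -/

section General

variable {G Ω : Type*} [AddCommGroup G] [MeasurableSpace G] [MeasurableSpace Ω]
  {ν : MeasureTheory.Measure G} {T : ShiftAction G Ω} (D : FluctuationDynamics ν T)
  [MeasurableNeg G] [ν.IsNegInvariant]

/-- `𝒬₀ ≤ S` iff the hydrodynamic projection `ℙ = P_{𝒬₀}` maps `ℋ` into `S` (`ℙ ψ ∈ 𝒬₀`, and
`ℙ ψ = ψ` on `𝒬₀`). [folklore] -/
theorem conservedSpace_le_iff_hydroProjection_mem (S : Submodule ℝ D.FluctuationSpace) :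
    D.conservedSpace ≤ S ↔ ∀ ψ, D.hydroProjection ψ ∈ S := by
  constructor
  · intro h ψ
    exact h (D.hydroProjection_mem ψ)
  · intro h ψ hψ
    rw [← D.hydroProjection_eq_self hψ]
    exact h ψ

/-- **Local observables suffice**: for a CLOSED subspace `S`, `𝒬₀ ≤ S` iff the hydrodynamic
projection of the class `[a]` of every local observable `a ∈ 𝒱` lies in `S` (the classes are dense,
`ℙ` is continuous, `S` is closed). In Doyon's language: the Euler-scale projection `ℙ a` of every
local observable is an `S`-vector. [folklore] -/
theorem conservedSpace_le_iff_hydroProjection_fluct_mem (S : Submodule ℝ D.FluctuationSpace)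
    (hS : IsClosed (S : Set D.FluctuationSpace)) :
    D.conservedSpace ≤ S ↔ ∀ a ∈ D.localObs, D.hydroProjection (D.fluct a) ∈ S := by
  rw [conservedSpace_le_iff_hydroProjection_mem]
  constructor
  · intro h a _
    exact h _
  · intro h ψ
    have hc : IsClosed {ψ : D.FluctuationSpace | D.hydroProjection ψ ∈ S} :=
      hS.preimage D.hydroProjection.continuous
    have hd : Dense (Set.range fun a : D.localObs => D.fluct (a : Ω → ℝ)) :=
      FluctuationStructure.dense_range_fluct
    have hsub : (Set.range fun a : D.localObs => D.fluct (a : Ω → ℝ)) ⊆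
        {ψ : D.FluctuationSpace | D.hydroProjection ψ ∈ S} := by
      rintro _ ⟨a, rfl⟩
      exact h a a.2
    have hall := hc.closure_subset_iff.2 hsub
    rw [hd.closure_eq] at hall
    exact hall (Set.mem_univ ψ)

/-! ## §2. Strong continuity: the Koopman group as a contraction semigroup, Cesàro means -/

/-- Under strong continuity the Koopman group `t ↦ U_t` is a strongly continuous contraction
(semi)group in the sense of `Mazur.IsContractionSemigroup` (group law, isometry). [folklore] -/
theorem isContractionSemigroup_koopmanCLM (h : D.IsStronglyContinuous) :
    Mazur.IsContractionSemigroup D.koopmanCLM where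
  map_add s t _ _ := D.koopmanCLM_add s t
  norm_le t _ := ContinuousLinearMap.opNorm_le_bound _ zero_le_one fun ψ => by
    rw [one_mul, D.norm_koopmanCLM]
  continuous ψ := h ψ

/-- The conserved vectors of the Koopman semigroup (`U_t x = x` for `t ≥ 0`) are exactly
`𝒬₀` (`U_t = U_{-t}⁻¹`). [folklore] -/
theorem invariantSubspace_koopmanCLM :
    Mazur.invariantSubspace D.koopmanCLM = D.conservedSpace := by
  ext ψ
  rw [Literature.Barriers.AtomisticToContinuum.Mazur.mem_invariantSubspace,
    FluctuationDynamics.mem_conservedSpace_iff]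
  constructor
  · intro h t
    rcases le_or_gt 0 t with ht | ht
    · exact h t ht
    · have h1 : D.koopman (-t) ψ = ψ := h (-t) (by linarith)
      calc D.koopman t ψ = D.koopman t (D.koopman (-t) ψ) := by rw [h1]
        _ = ψ := by rw [← D.koopman_add_apply, add_neg_cancel, D.koopman_zero_apply]
  · intro h t _
    exact h t

/-- The mean-ergodic projection of the Koopman semigroup is the hydrodynamic projection `ℙ`. [folklore] -/
theorem starProjection_invariantSubspace_koopmanCLM (ψ : D.FluctuationSpace) :
    (Mazur.invariantSubspace D.koopmanCLM).starProjection ψ = D.hydroProjection ψ := by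
  apply Submodule.eq_starProjection_of_mem_orthogonal
  · rw [invariantSubspace_koopmanCLM]
    exact D.hydroProjection_mem ψ
  · rw [invariantSubspace_koopmanCLM]
    exact D.conservedSpace.sub_starProjection_mem_orthogonal ψ

/-- **Von Neumann's mean ergodic theorem for the Koopman group on `ℋ`**: under strong continuity
the time averages `τ⁻¹ ∫₀^τ U_t ψ dt` converge to `ℙ ψ` (through `Mazur.tendsto_timeAverage`).
[cite: Doyon2022, §5.1 Thm 5.1] -/
theorem tendsto_timeAverage_koopman (h : D.IsStronglyContinuous) (ψ : D.FluctuationSpace) :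
    Tendsto (fun τ : ℝ => τ⁻¹ • ∫ t in (0 : ℝ)..τ, D.koopman t ψ) atTop
      (𝓝 (D.hydroProjection ψ)) := by
  have key := Literature.Barriers.AtomisticToContinuum.Mazur.tendsto_timeAverage
    (isContractionSemigroup_koopmanCLM D h) ψ
  rw [starProjection_invariantSubspace_koopmanCLM] at key
  exact key

/-- **The Drude weight is the Cesàro limit of the autocorrelation** (Doyon 2022 Thm 5.1: the
Cesàro limit `lim_τ τ⁻¹ ∫₀^τ ⟨τ_t a, a⟩₀ dt` exists and equals `⟨ℙ a, a⟩₀`; in the tree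
`drudeWeight ψ = ‖ℙ ψ‖²` is the DEFINITION and this identification "is von Neumann's mean ergodic
theorem and is NOT restated" there): under strong continuity,
`τ⁻¹ ∫₀^τ ⟪U_t ψ, ψ⟫ dt → 𝖣_ψ`. [cite: Doyon2022, §5.1 Thm 5.1] -/
theorem tendsto_cesaro_inner_koopman (h : D.IsStronglyContinuous) (ψ : D.FluctuationSpace) :
    Tendsto (fun τ : ℝ => τ⁻¹ * ∫ t in (0 : ℝ)..τ, ⟪D.koopman t ψ, ψ⟫_ℝ) atTop
      (𝓝 (D.drudeWeight ψ)) := by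
  have h1 : Tendsto (fun τ : ℝ => ⟪τ⁻¹ • ∫ t in (0 : ℝ)..τ, D.koopman t ψ, ψ⟫_ℝ) atTop
      (𝓝 ⟪D.hydroProjection ψ, ψ⟫_ℝ) :=
    (tendsto_timeAverage_koopman D h ψ).inner tendsto_const_nhds
  have h2 : ⟪D.hydroProjection ψ, ψ⟫_ℝ = D.drudeWeight ψ := by
    rw [D.drudeWeight_eq_inner]
    exact real_inner_comm _ _
  rw [← h2]
  refine h1.congr fun τ => ?_
  exact (Literature.Barriers.AtomisticToContinuum.Mazur.inv_mul_integral_inner_eq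
    (isContractionSemigroup_koopmanCLM D h) τ ψ).symm

/-- Zero Drude weight iff Cesàro-vanishing autocorrelation (strongly continuous case). [folklore] -/
theorem drudeWeight_eq_zero_iff_tendsto_cesaro (h : D.IsStronglyContinuous) (ψ : D.FluctuationSpace) :
    D.drudeWeight ψ = 0 ↔
      Tendsto (fun τ : ℝ => τ⁻¹ * ∫ t in (0 : ℝ)..τ, ⟪D.koopman t ψ, ψ⟫_ℝ) atTop (𝓝 0) := by
  constructor
  · intro h0
    simpa [h0] using tendsto_cesaro_inner_koopman D h ψ
  · intro ht
    exact tendsto_nhds_unique (tendsto_cesaro_inner_koopman D h ψ) ht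

/-- **Cesàro criterion**: for a closed subspace `S` of `ℋ` and a strongly continuous Koopman
group, `𝒬₀ ≤ S` iff every vector orthogonal to `S` has Cesàro-vanishing autocorrelation
`τ⁻¹ ∫₀^τ ⟪U_t φ, φ⟫ dt → 0` (zero Drude weight off `S`, Mazur / Suzuki). [folklore] -/
theorem conservedSpace_le_iff_cesaro (h : D.IsStronglyContinuous) (S : Submodule ℝ D.FluctuationSpace)
    [S.HasOrthogonalProjection] :
    D.conservedSpace ≤ S ↔ ∀ φ ∈ Sᗮ,
      Tendsto (fun τ : ℝ => τ⁻¹ * ∫ t in (0 : ℝ)..τ, ⟪D.koopman t φ, φ⟫_ℝ) atTop (𝓝 0) := by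
  rw [conservedSpace_le_iff_forall_drudeWeight_eq_zero D S]
  simp_rw [drudeWeight_eq_zero_iff_tendsto_cesaro D h]

/-- One-sided form: it suffices that the Cesàro means have non-positive `liminf`-type bound — if for
every `φ ⊥ S` and `ε > 0` there are arbitrarily large `τ` with `τ⁻¹ ∫₀^τ ⟪U_t φ, φ⟫ dt < ε`, then
`𝒬₀ ≤ S` (the Cesàro means converge to `𝖣_φ ≥ 0`). [folklore] -/
theorem conservedSpace_le_of_frequently_cesaro_lt (h : D.IsStronglyContinuous)
    (S : Submodule ℝ D.FluctuationSpace) [S.HasOrthogonalProjection]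
    (hyp : ∀ φ ∈ Sᗮ, ∀ ε : ℝ, 0 < ε →
      ∃ᶠ τ : ℝ in atTop, τ⁻¹ * ∫ t in (0 : ℝ)..τ, ⟪D.koopman t φ, φ⟫_ℝ < ε) :
    D.conservedSpace ≤ S := by
  rw [conservedSpace_le_iff_forall_drudeWeight_eq_zero D S]
  intro φ hφ
  have hlim := tendsto_cesaro_inner_koopman D h φ
  by_contra hne
  have hpos : 0 < D.drudeWeight φ := lt_of_le_of_ne (D.drudeWeight_nonneg φ) (Ne.symm hne)
  have hev : ∀ᶠ τ : ℝ in atTop,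
      D.drudeWeight φ / 2 < τ⁻¹ * ∫ t in (0 : ℝ)..τ, ⟪D.koopman t φ, φ⟫_ℝ :=
    hlim.eventually (lt_mem_nhds (by linarith))
  obtain ⟨τ, hτ1, hτ2⟩ :=
    ((hyp φ hφ (D.drudeWeight φ / 2) (by positivity)).and_eventually hev).exists
  linarith

end General

/-! ## §3. Hard spheres: the item's conclusion for one datum -/

section HardSpheres

variable {σ : ℝ} (F : HardSphereFluctuationData σ)

/-- The one-body sector is closed. [folklore] -/
theorem isClosed_oneBodySector : IsClosed (F.oneBodySector : Set (HardSphereFluctuationSpace F)) := by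
  rw [HardSphereFluctuationData.oneBodySector]
  exact Submodule.isClosed_topologicalClosure _

/-- **Projection form of the item for one datum**: `F.conservedSpace ≤ F.oneBodySector` iff the
hydrodynamic projection of (the class of) every local observable lies in the one-body sector `𝒟`
— "the Euler-scale projection of every local observable of the hard-sphere gas is a one-body
velocity field". [folklore] -/
theorem conservedSpace_le_oneBodySector_iff_hydroProjection_fluct_mem :
    F.conservedSpace ≤ F.oneBodySector ↔
      ∀ a ∈ F.localObs, F.hydroProjection (F.fluct a) ∈ F.oneBodySector :=
  conservedSpace_le_iff_hydroProjection_fluct_mem F.toFluctuationDynamics F.oneBodySector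
    (isClosed_oneBodySector F)

/-- **Cesàro form of the item for one datum** (strongly continuous Koopman group):
`F.conservedSpace ≤ F.oneBodySector` iff every vector of `ℋ` orthogonal to the one-body sector has
Cesàro-vanishing autocorrelation, `τ⁻¹ ∫₀^τ ⟪U_t φ, φ⟫ dt → 0`. [folklore] -/
theorem conservedSpace_le_oneBodySector_iff_cesaro (h : F.IsStronglyContinuous) :
    F.conservedSpace ≤ F.oneBodySector ↔ ∀ φ ∈ F.oneBodySectorᗮ,
      Tendsto (fun τ : ℝ => τ⁻¹ * ∫ t in (0 : ℝ)..τ, ⟪F.koopman t φ, φ⟫_ℝ) atTop (𝓝 0) := by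
  haveI := hasOrthogonalProjection_oneBodySector F
  exact conservedSpace_le_iff_cesaro F.toFluctuationDynamics h F.oneBodySector

end HardSpheres

/-! ## §4. The item's quantifier shape -/

/-- **`ConservedVectorsOneBody` from Cesàro mixing off the one-body sector** (engine-free road, in
the Cesàro shape of the route's torus crux `OneBodyCompleteness`): if for every diameter `σ > 0` and
inverse temperature `β > 0` there is an activity threshold below which every hard-sphere Gibbs datum
with (a.e.) Alexander flow has a strongly continuous Koopman group under which every vector
orthogonal to `𝒟` has Cesàro-vanishing autocorrelation, then the item holds. [folklore] -/
theorem conservedVectorsOneBody_of_cesaro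
    (hyp : ∀ σ : ℝ, 0 < σ → ∀ β : ℝ, 0 < β → ∃ z₀ : ℝ, 0 < z₀ ∧ ∀ z : ℝ, 0 < z → z < z₀ →
      ∀ F : HardSphereFluctuationData σ,
        Literature.Analysis.FluidPDE.IsHardSphereGibbs σ z β (0 : V3) F.μ →
        (∃ Φ : Literature.Analysis.FluidPDE.InfiniteHardSphereFlow (Fin 3) σ,
          Φ.IsEquilibriumFlow ∧ ∀ t : ℝ, F.flow t =ᵐ[F.μ] Φ.flow t) →
        F.IsStronglyContinuous ∧ ∀ φ ∈ F.oneBodySectorᗮ,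
          Tendsto (fun τ : ℝ => τ⁻¹ * ∫ t in (0 : ℝ)..τ, ⟪F.koopman t φ, φ⟫_ℝ) atTop (𝓝 0)) :
    ConservedVectorsOneBody := by
  intro σ hσ β hβ
  obtain ⟨z₀, hz₀, hz⟩ := hyp σ hσ β hβ
  refine ⟨z₀, hz₀, fun z hz1 hz2 F hG hΦ => ?_⟩
  obtain ⟨hsc, hces⟩ := hz z hz1 hz2 F hG hΦ
  exact (conservedSpace_le_oneBodySector_iff_cesaro F hsc).2 hces

/-- **`ConservedVectorsOneBody` in projection form**: the item is equivalent to "for every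
low-activity Gibbs datum with Alexander flow, the hydrodynamic projection of every local observable
is a one-body vector". [folklore] -/
theorem conservedVectorsOneBody_iff_hydroProjection :
    ConservedVectorsOneBody ↔
      ∀ σ : ℝ, 0 < σ → ∀ β : ℝ, 0 < β → ∃ z₀ : ℝ, 0 < z₀ ∧ ∀ z : ℝ, 0 < z → z < z₀ →
        ∀ F : HardSphereFluctuationData σ,
          Literature.Analysis.FluidPDE.IsHardSphereGibbs σ z β (0 : V3) F.μ →
          (∃ Φ : Literature.Analysis.FluidPDE.InfiniteHardSphereFlow (Fin 3) σ,
            Φ.IsEquilibriumFlow ∧ ∀ t : ℝ, F.flow t =ᵐ[F.μ] Φ.flow t) →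
          ∀ a ∈ F.localObs, F.hydroProjection (F.fluct a) ∈ F.oneBodySector := by
  constructor
  · intro h σ hσ β hβ
    obtain ⟨z₀, hz₀, hz⟩ := h σ hσ β hβ
    exact ⟨z₀, hz₀, fun z hz1 hz2 F hG hΦ =>
      (conservedSpace_le_oneBodySector_iff_hydroProjection_fluct_mem F).1 (hz z hz1 hz2 F hG hΦ)⟩
  · intro h σ hσ β hβ
    obtain ⟨z₀, hz₀, hz⟩ := h σ hσ β hβ
    exact ⟨z₀, hz₀, fun z hz1 hz2 F hG hΦ =>
      (conservedSpace_le_oneBodySector_iff_hydroProjection_fluct_mem F).2 (hz z hz1 hz2 F hG hΦ)⟩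

/-- `ConservedVectorsOneBody` from the projection hypothesis (the `←` direction of
`conservedVectorsOneBody_iff_hydroProjection`, as an implication). [folklore] -/
theorem conservedVectorsOneBody_of_hydroProjection
    (hyp : ∀ σ : ℝ, 0 < σ → ∀ β : ℝ, 0 < β → ∃ z₀ : ℝ, 0 < z₀ ∧ ∀ z : ℝ, 0 < z → z < z₀ →
      ∀ F : HardSphereFluctuationData σ,
        Literature.Analysis.FluidPDE.IsHardSphereGibbs σ z β (0 : V3) F.μ →
        (∃ Φ : Literature.Analysis.FluidPDE.InfiniteHardSphereFlow (Fin 3) σ,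
          Φ.IsEquilibriumFlow ∧ ∀ t : ℝ, F.flow t =ᵐ[F.μ] Φ.flow t) →
        ∀ a ∈ F.localObs, F.hydroProjection (F.fluct a) ∈ F.oneBodySector) :
    ConservedVectorsOneBody :=
  conservedVectorsOneBody_iff_hydroProjection.2 hyp

/-- `ConservedVectorsOneBody` from the one-sided Cesàro hypothesis: strong continuity and, for
every `φ ⊥ 𝒟` and `ε > 0`, arbitrarily long windows with Cesàro mean of the autocorrelation
below `ε`. [folklore] -/
theorem conservedVectorsOneBody_of_frequently_cesaro_lt
    (hyp : ∀ σ : ℝ, 0 < σ → ∀ β : ℝ, 0 < β → ∃ z₀ : ℝ, 0 < z₀ ∧ ∀ z : ℝ, 0 < z → z < z₀ →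
      ∀ F : HardSphereFluctuationData σ,
        Literature.Analysis.FluidPDE.IsHardSphereGibbs σ z β (0 : V3) F.μ →
        (∃ Φ : Literature.Analysis.FluidPDE.InfiniteHardSphereFlow (Fin 3) σ,
          Φ.IsEquilibriumFlow ∧ ∀ t : ℝ, F.flow t =ᵐ[F.μ] Φ.flow t) →
        F.IsStronglyContinuous ∧ ∀ φ ∈ F.oneBodySectorᗮ, ∀ ε : ℝ, 0 < ε →
          ∃ᶠ τ : ℝ in atTop, τ⁻¹ * ∫ t in (0 : ℝ)..τ, ⟪F.koopman t φ, φ⟫_ℝ < ε) :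
    ConservedVectorsOneBody := by
  intro σ hσ β hβ
  obtain ⟨z₀, hz₀, hz⟩ := hyp σ hσ β hβ
  refine ⟨z₀, hz₀, fun z hz1 hz2 F hG hΦ => ?_⟩
  obtain ⟨hsc, hces⟩ := hz z hz1 hz2 F hG hΦ
  haveI := hasOrthogonalProjection_oneBodySector F
  exact conservedSpace_le_of_frequently_cesaro_lt F.toFluctuationDynamics hsc F.oneBodySector hces

end MourreKoopmanChargesConservedVectorsOneBody

end Summit.AtomisticToContinuum.HydrodynamicLimit.Theorems
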